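import Mathlib
import Summits.Ventures.PercRepro2.Defs
import Summits.Ventures.PercRepro2.Graph
import Summits.Ventures.PercRepro2.OneColourSwitch
import Summits.Ventures.PercRepro2.RegionHubSign
import Summits.Ventures.PercRepro2.SideSwitch
import Summits.Ventures.PercRepro2.SideSwitchComps
import Summits.Ventures.PercRepro2.M9NoPocketDefs
import Summits.Ventures.PercRepro2.M9GeneralDSplit
import Summits.Ventures.PercRepro2.M9GeneralDHD
import Summits.Ventures.PercRepro2.M9PocketUnitKonly
import Summits.Ventures.PercRepro2.M9PocketHDTheorem
import Summits.Ventures.PercRepro2.M9PocketRSEdgeTransfer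
import Summits.Ventures.PercRepro2.M9PocketRootOnlyTransfer
import Summits.Ventures.PercRepro2.M9PocketRSDTransfer
import Summits.Ventures.PercRepro2.M9PocketRSDJoin
import Summits.Ventures.PercRepro2.M9PocketRSDWorlds
import Summits.Ventures.PercRepro2.M9PocketRSDGlue
import Summits.Ventures.PercRepro2.M9PocketRSDSum
import Summits.Ventures.PercRepro2.M9PocketProdAssemblyT
import Summits.Ventures.PercRepro2.M9PocketProdWeightT
import Summits.Ventures.PercRepro2.M9PocketVirtualEdge
import Summits.Ventures.PercRepro2.M9PocketVirtualKonly
import Summits.Ventures.PercRepro2.M9PocketRSDOutside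
import Summits.Ventures.PercRepro2.M9PocketRSDSymbols
import Summits.Ventures.PercRepro2.M9PocketRSDArith
import Summits.Ventures.PercRepro2.M9PocketRSDInner
import Summits.Ventures.PercRepro2.M9PocketRSDInnerRS
import Summits.Ventures.PercRepro2.M9PocketRSDInnerRD
import Summits.Ventures.PercRepro2.M9PocketRSDInnerSD
import Summits.Ventures.PercRepro2.M9PocketRSDInnerRSD

/-!
# THE THEOREM: a cluster hanging from `{r, s, d}` — `hdK ≤ 0` modulo the F-count inequalities
(blind cell PercRepro2, p3 g42, 2026-08-30; `proofs/P3-POCKETRK.md` §10⁶)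

`L` a vertex set with `p, q, r, s, d ∉ L` every edge of which ends in `L ∪ {r, s, d}` (a linking
block with the pocket vertices it is attached to), `F` the edges inside `L ∪ {r, s, d}`; the
outside `G − F` has no edge inside `{r, s}` and is non-linking.  If the admissible colourings
of `F` (classified by the `Y_F`-partition of the exits, the `W`-link `w`, the dead end `δ_F`)
satisfy `#{∅, w, δ} ≤ #{rs, ¬w, δ}` and `#{rd, w, δ} + #{sd, w, δ} ≤ #{rsd, ¬w, δ}` for `δ` true and
false, then the `K`-half of the hub–dead-end sum is `≤ 0` (`hdK_nonpos_of_cluster_rsd`) and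
`dSignSum ≤ 0` (`dSignSum_nonpos_of_cluster_rsd`): `hdK_eq_sum_rsd`, the inner sums by class,
the five outside sums `≤ 0`, and `sum_classes_nonpos_p3`.  The count inequalities hold for every
cluster by the injections of §10⁶ (e) (kernel: the successor's item).  Own work; std axioms.
-/

namespace Summit.Ventures.PercRepro2

namespace NoPocket

open Finset Classical OneColourSwitch SideSwitch

variable {V : Type*} {E : Type*} {ends : E → Sym2 V} {p q r s d : V} {L : Set V}

section Theorem

variable [Fintype V] [DecidableEq V] [Fintype E] [DecidableEq E]

/-- **The `K`-half of the hub–dead-end sum is non-positive** for a cluster hanging from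
`{r, s, d}` with a non-linking outside, modulo the F-count inequalities on the cluster. -/
theorem hdK_nonpos_of_cluster_rsd
    (hL : ∀ e x y, ends e = s(x, y) → x ∈ L → y ∈ L ∨ y = r ∨ y = s ∨ y = d)
    (hp : p ∉ L) (hq : q ∉ L) (hr : r ∉ L) (hs : s ∉ L) (hd : d ∉ L) (hdr : d ≠ r) (hds : d ≠ s)
    (hrs : within (fun e : {e // e ∉ within ends (L ∪ {r, s, d} : Set V)} => ends e.1) ({r, s} : Set V) = ∅)
    (hsepN : ¬ Conn (endsD (fun e : {e // e ∉ within ends (L ∪ {r, s, d} : Set V)} => ends e.1) d) (chi (endsD (fun e : {e // e ∉ within ends (L ∪ {r, s, d} : Set V)} => ends e.1) d)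
      ({x : V | ∀ e : {e // e ∉ within ends (L ∪ {r, s, d} : Set V)}, (fun e : {e // e ∉ within ends (L ∪ {r, s, d} : Set V)} => ends e.1) e ≠ s(d, x)} ∪ {r, s})) r s)
    (hC1t : (∑ τ : {e // ¬ (e ∉ within ends (L ∪ {r, s, d} : Set V))} → Bool, if (d ∉ M2 (fun e : {e // ¬ (e ∉ within ends (L ∪ {r, s, d} : Set V))} => ends e.1) r s τ ∧
          ∀ x ∈ L,
            (Conn (fun e : {e // ¬ (e ∉ within ends (L ∪ {r, s, d} : Set V))} => ends e.1) τ r x ∨ Conn (fun e : {e // ¬ (e ∉ within ends (L ∪ {r, s, d} : Set V))} => ends e.1) τ s x ∨ Conn (fun e : {e // ¬ (e ∉ within ends (L ∪ {r, s, d} : Set V))} => ends e.1) τ d x) →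
            x ∉ M2 (fun e : {e // ¬ (e ∉ within ends (L ∪ {r, s, d} : Set V))} => ends e.1) r s τ) ∧ (¬ Conn (fun e : {e // ¬ (e ∉ within ends (L ∪ {r, s, d} : Set V))} => ends e.1) τ r s ∧ ¬ Conn (fun e : {e // ¬ (e ∉ within ends (L ∪ {r, s, d} : Set V))} => ends e.1) τ r d ∧ ¬ Conn (fun e : {e // ¬ (e ∉ within ends (L ∪ {r, s, d} : Set V))} => ends e.1) τ d s) ∧ Conn (fun e : {e // ¬ (e ∉ within ends (L ∪ {r, s, d} : Set V))} => ends e.1) (OneColourSwitch.compl τ) r s ∧ (∃ x ∈ L,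
          (Conn (fun e : {e // ¬ (e ∉ within ends (L ∪ {r, s, d} : Set V))} => ends e.1) τ r x ∨ Conn (fun e : {e // ¬ (e ∉ within ends (L ∪ {r, s, d} : Set V))} => ends e.1) τ s x ∨ Conn (fun e : {e // ¬ (e ∉ within ends (L ∪ {r, s, d} : Set V))} => ends e.1) τ d x) ∧
          Conn (fun e : {e // ¬ (e ∉ within ends (L ∪ {r, s, d} : Set V))} => ends e.1) (OneColourSwitch.compl τ) d x) then (1 : ℤ) else 0) ≤ (∑ τ : {e // ¬ (e ∉ within ends (L ∪ {r, s, d} : Set V))} → Bool, if (d ∉ M2 (fun e : {e // ¬ (e ∉ within ends (L ∪ {r, s, d} : Set V))} => ends e.1) r s τ ∧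
          ∀ x ∈ L,
            (Conn (fun e : {e // ¬ (e ∉ within ends (L ∪ {r, s, d} : Set V))} => ends e.1) τ r x ∨ Conn (fun e : {e // ¬ (e ∉ within ends (L ∪ {r, s, d} : Set V))} => ends e.1) τ s x ∨ Conn (fun e : {e // ¬ (e ∉ within ends (L ∪ {r, s, d} : Set V))} => ends e.1) τ d x) →
            x ∉ M2 (fun e : {e // ¬ (e ∉ within ends (L ∪ {r, s, d} : Set V))} => ends e.1) r s τ) ∧ (Conn (fun e : {e // ¬ (e ∉ within ends (L ∪ {r, s, d} : Set V))} => ends e.1) τ r s ∧ ¬ Conn (fun e : {e // ¬ (e ∉ within ends (L ∪ {r, s, d} : Set V))} => ends e.1) τ r d ∧ ¬ Conn (fun e : {e // ¬ (e ∉ within ends (L ∪ {r, s, d} : Set V))} => ends e.1) τ d s) ∧ ¬ Conn (fun e : {e // ¬ (e ∉ within ends (L ∪ {r, s, d} : Set V))} => ends e.1) (OneColourSwitch.compl τ) r s ∧ (∃ x ∈ L,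
          (Conn (fun e : {e // ¬ (e ∉ within ends (L ∪ {r, s, d} : Set V))} => ends e.1) τ r x ∨ Conn (fun e : {e // ¬ (e ∉ within ends (L ∪ {r, s, d} : Set V))} => ends e.1) τ s x ∨ Conn (fun e : {e // ¬ (e ∉ within ends (L ∪ {r, s, d} : Set V))} => ends e.1) τ d x) ∧
          Conn (fun e : {e // ¬ (e ∉ within ends (L ∪ {r, s, d} : Set V))} => ends e.1) (OneColourSwitch.compl τ) d x) then (1 : ℤ) else 0))
    (hC1f : (∑ τ : {e // ¬ (e ∉ within ends (L ∪ {r, s, d} : Set V))} → Bool, if (d ∉ M2 (fun e : {e // ¬ (e ∉ within ends (L ∪ {r, s, d} : Set V))} => ends e.1) r s τ ∧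
          ∀ x ∈ L,
            (Conn (fun e : {e // ¬ (e ∉ within ends (L ∪ {r, s, d} : Set V))} => ends e.1) τ r x ∨ Conn (fun e : {e // ¬ (e ∉ within ends (L ∪ {r, s, d} : Set V))} => ends e.1) τ s x ∨ Conn (fun e : {e // ¬ (e ∉ within ends (L ∪ {r, s, d} : Set V))} => ends e.1) τ d x) →
            x ∉ M2 (fun e : {e // ¬ (e ∉ within ends (L ∪ {r, s, d} : Set V))} => ends e.1) r s τ) ∧ (¬ Conn (fun e : {e // ¬ (e ∉ within ends (L ∪ {r, s, d} : Set V))} => ends e.1) τ r s ∧ ¬ Conn (fun e : {e // ¬ (e ∉ within ends (L ∪ {r, s, d} : Set V))} => ends e.1) τ r d ∧ ¬ Conn (fun e : {e // ¬ (e ∉ within ends (L ∪ {r, s, d} : Set V))} => ends e.1) τ d s) ∧ Conn (fun e : {e // ¬ (e ∉ within ends (L ∪ {r, s, d} : Set V))} => ends e.1) (OneColourSwitch.compl τ) r s ∧ ¬ (∃ x ∈ L,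
          (Conn (fun e : {e // ¬ (e ∉ within ends (L ∪ {r, s, d} : Set V))} => ends e.1) τ r x ∨ Conn (fun e : {e // ¬ (e ∉ within ends (L ∪ {r, s, d} : Set V))} => ends e.1) τ s x ∨ Conn (fun e : {e // ¬ (e ∉ within ends (L ∪ {r, s, d} : Set V))} => ends e.1) τ d x) ∧
          Conn (fun e : {e // ¬ (e ∉ within ends (L ∪ {r, s, d} : Set V))} => ends e.1) (OneColourSwitch.compl τ) d x) then (1 : ℤ) else 0) ≤ (∑ τ : {e // ¬ (e ∉ within ends (L ∪ {r, s, d} : Set V))} → Bool, if (d ∉ M2 (fun e : {e // ¬ (e ∉ within ends (L ∪ {r, s, d} : Set V))} => ends e.1) r s τ ∧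
          ∀ x ∈ L,
            (Conn (fun e : {e // ¬ (e ∉ within ends (L ∪ {r, s, d} : Set V))} => ends e.1) τ r x ∨ Conn (fun e : {e // ¬ (e ∉ within ends (L ∪ {r, s, d} : Set V))} => ends e.1) τ s x ∨ Conn (fun e : {e // ¬ (e ∉ within ends (L ∪ {r, s, d} : Set V))} => ends e.1) τ d x) →
            x ∉ M2 (fun e : {e // ¬ (e ∉ within ends (L ∪ {r, s, d} : Set V))} => ends e.1) r s τ) ∧ (Conn (fun e : {e // ¬ (e ∉ within ends (L ∪ {r, s, d} : Set V))} => ends e.1) τ r s ∧ ¬ Conn (fun e : {e // ¬ (e ∉ within ends (L ∪ {r, s, d} : Set V))} => ends e.1) τ r d ∧ ¬ Conn (fun e : {e // ¬ (e ∉ within ends (L ∪ {r, s, d} : Set V))} => ends e.1) τ d s) ∧ ¬ Conn (fun e : {e // ¬ (e ∉ within ends (L ∪ {r, s, d} : Set V))} => ends e.1) (OneColourSwitch.compl τ) r s ∧ ¬ (∃ x ∈ L,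
          (Conn (fun e : {e // ¬ (e ∉ within ends (L ∪ {r, s, d} : Set V))} => ends e.1) τ r x ∨ Conn (fun e : {e // ¬ (e ∉ within ends (L ∪ {r, s, d} : Set V))} => ends e.1) τ s x ∨ Conn (fun e : {e // ¬ (e ∉ within ends (L ∪ {r, s, d} : Set V))} => ends e.1) τ d x) ∧
          Conn (fun e : {e // ¬ (e ∉ within ends (L ∪ {r, s, d} : Set V))} => ends e.1) (OneColourSwitch.compl τ) d x) then (1 : ℤ) else 0))
    (hC2t : (∑ τ : {e // ¬ (e ∉ within ends (L ∪ {r, s, d} : Set V))} → Bool, if (d ∉ M2 (fun e : {e // ¬ (e ∉ within ends (L ∪ {r, s, d} : Set V))} => ends e.1) r s τ ∧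
          ∀ x ∈ L,
            (Conn (fun e : {e // ¬ (e ∉ within ends (L ∪ {r, s, d} : Set V))} => ends e.1) τ r x ∨ Conn (fun e : {e // ¬ (e ∉ within ends (L ∪ {r, s, d} : Set V))} => ends e.1) τ s x ∨ Conn (fun e : {e // ¬ (e ∉ within ends (L ∪ {r, s, d} : Set V))} => ends e.1) τ d x) →
            x ∉ M2 (fun e : {e // ¬ (e ∉ within ends (L ∪ {r, s, d} : Set V))} => ends e.1) r s τ) ∧ (Conn (fun e : {e // ¬ (e ∉ within ends (L ∪ {r, s, d} : Set V))} => ends e.1) τ r d ∧ ¬ Conn (fun e : {e // ¬ (e ∉ within ends (L ∪ {r, s, d} : Set V))} => ends e.1) τ d s) ∧ Conn (fun e : {e // ¬ (e ∉ within ends (L ∪ {r, s, d} : Set V))} => ends e.1) (OneColourSwitch.compl τ) r s ∧ (∃ x ∈ L,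
          (Conn (fun e : {e // ¬ (e ∉ within ends (L ∪ {r, s, d} : Set V))} => ends e.1) τ r x ∨ Conn (fun e : {e // ¬ (e ∉ within ends (L ∪ {r, s, d} : Set V))} => ends e.1) τ s x ∨ Conn (fun e : {e // ¬ (e ∉ within ends (L ∪ {r, s, d} : Set V))} => ends e.1) τ d x) ∧
          Conn (fun e : {e // ¬ (e ∉ within ends (L ∪ {r, s, d} : Set V))} => ends e.1) (OneColourSwitch.compl τ) d x) then (1 : ℤ) else 0) + (∑ τ : {e // ¬ (e ∉ within ends (L ∪ {r, s, d} : Set V))} → Bool, if (d ∉ M2 (fun e : {e // ¬ (e ∉ within ends (L ∪ {r, s, d} : Set V))} => ends e.1) r s τ ∧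
          ∀ x ∈ L,
            (Conn (fun e : {e // ¬ (e ∉ within ends (L ∪ {r, s, d} : Set V))} => ends e.1) τ r x ∨ Conn (fun e : {e // ¬ (e ∉ within ends (L ∪ {r, s, d} : Set V))} => ends e.1) τ s x ∨ Conn (fun e : {e // ¬ (e ∉ within ends (L ∪ {r, s, d} : Set V))} => ends e.1) τ d x) →
            x ∉ M2 (fun e : {e // ¬ (e ∉ within ends (L ∪ {r, s, d} : Set V))} => ends e.1) r s τ) ∧ (¬ Conn (fun e : {e // ¬ (e ∉ within ends (L ∪ {r, s, d} : Set V))} => ends e.1) τ r d ∧ Conn (fun e : {e // ¬ (e ∉ within ends (L ∪ {r, s, d} : Set V))} => ends e.1) τ d s) ∧ Conn (fun e : {e // ¬ (e ∉ within ends (L ∪ {r, s, d} : Set V))} => ends e.1) (OneColourSwitch.compl τ) r s ∧ (∃ x ∈ L,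
          (Conn (fun e : {e // ¬ (e ∉ within ends (L ∪ {r, s, d} : Set V))} => ends e.1) τ r x ∨ Conn (fun e : {e // ¬ (e ∉ within ends (L ∪ {r, s, d} : Set V))} => ends e.1) τ s x ∨ Conn (fun e : {e // ¬ (e ∉ within ends (L ∪ {r, s, d} : Set V))} => ends e.1) τ d x) ∧
          Conn (fun e : {e // ¬ (e ∉ within ends (L ∪ {r, s, d} : Set V))} => ends e.1) (OneColourSwitch.compl τ) d x) then (1 : ℤ) else 0) ≤ (∑ τ : {e // ¬ (e ∉ within ends (L ∪ {r, s, d} : Set V))} → Bool, if (d ∉ M2 (fun e : {e // ¬ (e ∉ within ends (L ∪ {r, s, d} : Set V))} => ends e.1) r s τ ∧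
          ∀ x ∈ L,
            (Conn (fun e : {e // ¬ (e ∉ within ends (L ∪ {r, s, d} : Set V))} => ends e.1) τ r x ∨ Conn (fun e : {e // ¬ (e ∉ within ends (L ∪ {r, s, d} : Set V))} => ends e.1) τ s x ∨ Conn (fun e : {e // ¬ (e ∉ within ends (L ∪ {r, s, d} : Set V))} => ends e.1) τ d x) →
            x ∉ M2 (fun e : {e // ¬ (e ∉ within ends (L ∪ {r, s, d} : Set V))} => ends e.1) r s τ) ∧ (Conn (fun e : {e // ¬ (e ∉ within ends (L ∪ {r, s, d} : Set V))} => ends e.1) τ r d ∧ Conn (fun e : {e // ¬ (e ∉ within ends (L ∪ {r, s, d} : Set V))} => ends e.1) τ d s) ∧ ¬ Conn (fun e : {e // ¬ (e ∉ within ends (L ∪ {r, s, d} : Set V))} => ends e.1) (OneColourSwitch.compl τ) r s ∧ (∃ x ∈ L,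
          (Conn (fun e : {e // ¬ (e ∉ within ends (L ∪ {r, s, d} : Set V))} => ends e.1) τ r x ∨ Conn (fun e : {e // ¬ (e ∉ within ends (L ∪ {r, s, d} : Set V))} => ends e.1) τ s x ∨ Conn (fun e : {e // ¬ (e ∉ within ends (L ∪ {r, s, d} : Set V))} => ends e.1) τ d x) ∧
          Conn (fun e : {e // ¬ (e ∉ within ends (L ∪ {r, s, d} : Set V))} => ends e.1) (OneColourSwitch.compl τ) d x) then (1 : ℤ) else 0))
    (hC2f : (∑ τ : {e // ¬ (e ∉ within ends (L ∪ {r, s, d} : Set V))} → Bool, if (d ∉ M2 (fun e : {e // ¬ (e ∉ within ends (L ∪ {r, s, d} : Set V))} => ends e.1) r s τ ∧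
          ∀ x ∈ L,
            (Conn (fun e : {e // ¬ (e ∉ within ends (L ∪ {r, s, d} : Set V))} => ends e.1) τ r x ∨ Conn (fun e : {e // ¬ (e ∉ within ends (L ∪ {r, s, d} : Set V))} => ends e.1) τ s x ∨ Conn (fun e : {e // ¬ (e ∉ within ends (L ∪ {r, s, d} : Set V))} => ends e.1) τ d x) →
            x ∉ M2 (fun e : {e // ¬ (e ∉ within ends (L ∪ {r, s, d} : Set V))} => ends e.1) r s τ) ∧ (Conn (fun e : {e // ¬ (e ∉ within ends (L ∪ {r, s, d} : Set V))} => ends e.1) τ r d ∧ ¬ Conn (fun e : {e // ¬ (e ∉ within ends (L ∪ {r, s, d} : Set V))} => ends e.1) τ d s) ∧ Conn (fun e : {e // ¬ (e ∉ within ends (L ∪ {r, s, d} : Set V))} => ends e.1) (OneColourSwitch.compl τ) r s ∧ ¬ (∃ x ∈ L,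
          (Conn (fun e : {e // ¬ (e ∉ within ends (L ∪ {r, s, d} : Set V))} => ends e.1) τ r x ∨ Conn (fun e : {e // ¬ (e ∉ within ends (L ∪ {r, s, d} : Set V))} => ends e.1) τ s x ∨ Conn (fun e : {e // ¬ (e ∉ within ends (L ∪ {r, s, d} : Set V))} => ends e.1) τ d x) ∧
          Conn (fun e : {e // ¬ (e ∉ within ends (L ∪ {r, s, d} : Set V))} => ends e.1) (OneColourSwitch.compl τ) d x) then (1 : ℤ) else 0) + (∑ τ : {e // ¬ (e ∉ within ends (L ∪ {r, s, d} : Set V))} → Bool, if (d ∉ M2 (fun e : {e // ¬ (e ∉ within ends (L ∪ {r, s, d} : Set V))} => ends e.1) r s τ ∧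
          ∀ x ∈ L,
            (Conn (fun e : {e // ¬ (e ∉ within ends (L ∪ {r, s, d} : Set V))} => ends e.1) τ r x ∨ Conn (fun e : {e // ¬ (e ∉ within ends (L ∪ {r, s, d} : Set V))} => ends e.1) τ s x ∨ Conn (fun e : {e // ¬ (e ∉ within ends (L ∪ {r, s, d} : Set V))} => ends e.1) τ d x) →
            x ∉ M2 (fun e : {e // ¬ (e ∉ within ends (L ∪ {r, s, d} : Set V))} => ends e.1) r s τ) ∧ (¬ Conn (fun e : {e // ¬ (e ∉ within ends (L ∪ {r, s, d} : Set V))} => ends e.1) τ r d ∧ Conn (fun e : {e // ¬ (e ∉ within ends (L ∪ {r, s, d} : Set V))} => ends e.1) τ d s) ∧ Conn (fun e : {e // ¬ (e ∉ within ends (L ∪ {r, s, d} : Set V))} => ends e.1) (OneColourSwitch.compl τ) r s ∧ ¬ (∃ x ∈ L,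
          (Conn (fun e : {e // ¬ (e ∉ within ends (L ∪ {r, s, d} : Set V))} => ends e.1) τ r x ∨ Conn (fun e : {e // ¬ (e ∉ within ends (L ∪ {r, s, d} : Set V))} => ends e.1) τ s x ∨ Conn (fun e : {e // ¬ (e ∉ within ends (L ∪ {r, s, d} : Set V))} => ends e.1) τ d x) ∧
          Conn (fun e : {e // ¬ (e ∉ within ends (L ∪ {r, s, d} : Set V))} => ends e.1) (OneColourSwitch.compl τ) d x) then (1 : ℤ) else 0) ≤ (∑ τ : {e // ¬ (e ∉ within ends (L ∪ {r, s, d} : Set V))} → Bool, if (d ∉ M2 (fun e : {e // ¬ (e ∉ within ends (L ∪ {r, s, d} : Set V))} => ends e.1) r s τ ∧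
          ∀ x ∈ L,
            (Conn (fun e : {e // ¬ (e ∉ within ends (L ∪ {r, s, d} : Set V))} => ends e.1) τ r x ∨ Conn (fun e : {e // ¬ (e ∉ within ends (L ∪ {r, s, d} : Set V))} => ends e.1) τ s x ∨ Conn (fun e : {e // ¬ (e ∉ within ends (L ∪ {r, s, d} : Set V))} => ends e.1) τ d x) →
            x ∉ M2 (fun e : {e // ¬ (e ∉ within ends (L ∪ {r, s, d} : Set V))} => ends e.1) r s τ) ∧ (Conn (fun e : {e // ¬ (e ∉ within ends (L ∪ {r, s, d} : Set V))} => ends e.1) τ r d ∧ Conn (fun e : {e // ¬ (e ∉ within ends (L ∪ {r, s, d} : Set V))} => ends e.1) τ d s) ∧ ¬ Conn (fun e : {e // ¬ (e ∉ within ends (L ∪ {r, s, d} : Set V))} => ends e.1) (OneColourSwitch.compl τ) r s ∧ ¬ (∃ x ∈ L,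
          (Conn (fun e : {e // ¬ (e ∉ within ends (L ∪ {r, s, d} : Set V))} => ends e.1) τ r x ∨ Conn (fun e : {e // ¬ (e ∉ within ends (L ∪ {r, s, d} : Set V))} => ends e.1) τ s x ∨ Conn (fun e : {e // ¬ (e ∉ within ends (L ∪ {r, s, d} : Set V))} => ends e.1) τ d x) ∧
          Conn (fun e : {e // ¬ (e ∉ within ends (L ∪ {r, s, d} : Set V))} => ends e.1) (OneColourSwitch.compl τ) d x) then (1 : ℤ) else 0)) :
    (∑ ω : Config E, if HD ends p q r s d ω ∧ d ∈ K2 ends r s ω then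
      sigma ends ω p q * sigma ends ω r s else 0) ≤ 0 := by
  rw [hdK_eq_sum_rsd hL hp hq hr hs hd, Finset.sum_comm]
  have hX := fun δ : Prop => sum_X_nonpos (ends := (fun e : {e // e ∉ within ends (L ∪ {r, s, d} : Set V)} => ends e.1)) (p := p) (q := q) hdr hds hrs hsepN δ
  have hY := fun δ : Prop => sum_Y_nonpos (ends := (fun e : {e // e ∉ within ends (L ∪ {r, s, d} : Set V)} => ends e.1)) (p := p) (q := q) hdr hds hrs hsepN δ
  have hX' := fun δ : Prop => sum_X'_nonpos (ends := (fun e : {e // e ∉ within ends (L ∪ {r, s, d} : Set V)} => ends e.1)) (p := p) (q := q) hdr hds hrs hsepN δ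
  have hZr := fun δ : Prop => sum_Zr_nonpos (ends := (fun e : {e // e ∉ within ends (L ∪ {r, s, d} : Set V)} => ends e.1)) (p := p) (q := q) hdr hds hrs hsepN δ
  have hZs := fun δ : Prop => sum_Zs_nonpos (ends := (fun e : {e // e ∉ within ends (L ∪ {r, s, d} : Set V)} => ends e.1)) (p := p) (q := q) hdr hds hrs hsepN δ
  refine sum_classes_nonpos_p3 (fun τ => (d ∉ M2 (fun e : {e // ¬ (e ∉ within ends (L ∪ {r, s, d} : Set V))} => ends e.1) r s τ ∧
          ∀ x ∈ L,
            (Conn (fun e : {e // ¬ (e ∉ within ends (L ∪ {r, s, d} : Set V))} => ends e.1) τ r x ∨ Conn (fun e : {e // ¬ (e ∉ within ends (L ∪ {r, s, d} : Set V))} => ends e.1) τ s x ∨ Conn (fun e : {e // ¬ (e ∉ within ends (L ∪ {r, s, d} : Set V))} => ends e.1) τ d x) →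
            x ∉ M2 (fun e : {e // ¬ (e ∉ within ends (L ∪ {r, s, d} : Set V))} => ends e.1) r s τ)) (fun τ => (¬ Conn (fun e : {e // ¬ (e ∉ within ends (L ∪ {r, s, d} : Set V))} => ends e.1) τ r s ∧ ¬ Conn (fun e : {e // ¬ (e ∉ within ends (L ∪ {r, s, d} : Set V))} => ends e.1) τ r d ∧ ¬ Conn (fun e : {e // ¬ (e ∉ within ends (L ∪ {r, s, d} : Set V))} => ends e.1) τ d s)) (fun τ => (Conn (fun e : {e // ¬ (e ∉ within ends (L ∪ {r, s, d} : Set V))} => ends e.1) τ r s ∧ ¬ Conn (fun e : {e // ¬ (e ∉ within ends (L ∪ {r, s, d} : Set V))} => ends e.1) τ r d ∧ ¬ Conn (fun e : {e // ¬ (e ∉ within ends (L ∪ {r, s, d} : Set V))} => ends e.1) τ d s))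
    (fun τ => (Conn (fun e : {e // ¬ (e ∉ within ends (L ∪ {r, s, d} : Set V))} => ends e.1) τ r d ∧ ¬ Conn (fun e : {e // ¬ (e ∉ within ends (L ∪ {r, s, d} : Set V))} => ends e.1) τ d s)) (fun τ => (¬ Conn (fun e : {e // ¬ (e ∉ within ends (L ∪ {r, s, d} : Set V))} => ends e.1) τ r d ∧ Conn (fun e : {e // ¬ (e ∉ within ends (L ∪ {r, s, d} : Set V))} => ends e.1) τ d s)) (fun τ => (Conn (fun e : {e // ¬ (e ∉ within ends (L ∪ {r, s, d} : Set V))} => ends e.1) τ r d ∧ Conn (fun e : {e // ¬ (e ∉ within ends (L ∪ {r, s, d} : Set V))} => ends e.1) τ d s)) (fun τ => Conn (fun e : {e // ¬ (e ∉ within ends (L ∪ {r, s, d} : Set V))} => ends e.1) (OneColourSwitch.compl τ) r s) (fun τ => (∃ x ∈ L,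
          (Conn (fun e : {e // ¬ (e ∉ within ends (L ∪ {r, s, d} : Set V))} => ends e.1) τ r x ∨ Conn (fun e : {e // ¬ (e ∉ within ends (L ∪ {r, s, d} : Set V))} => ends e.1) τ s x ∨ Conn (fun e : {e // ¬ (e ∉ within ends (L ∪ {r, s, d} : Set V))} => ends e.1) τ d x) ∧
          Conn (fun e : {e // ¬ (e ∉ within ends (L ∪ {r, s, d} : Set V))} => ends e.1) (OneColourSwitch.compl τ) d x))
    _ _ _ _ _ hX hY hX' hZr hZs _ (fun τ => ?_) ?_ ?_ ?_ ?_
  rotate_left 1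
  · convert hC1t
  · convert hC1f
  · convert hC2t
  · convert hC2f
  -- the pointwise decomposition by class
  by_cases hA : (d ∉ M2 (fun e : {e // ¬ (e ∉ within ends (L ∪ {r, s, d} : Set V))} => ends e.1) r s τ ∧
          ∀ x ∈ L,
            (Conn (fun e : {e // ¬ (e ∉ within ends (L ∪ {r, s, d} : Set V))} => ends e.1) τ r x ∨ Conn (fun e : {e // ¬ (e ∉ within ends (L ∪ {r, s, d} : Set V))} => ends e.1) τ s x ∨ Conn (fun e : {e // ¬ (e ∉ within ends (L ∪ {r, s, d} : Set V))} => ends e.1) τ d x) →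
            x ∉ M2 (fun e : {e // ¬ (e ∉ within ends (L ∪ {r, s, d} : Set V))} => ends e.1) r s τ)
  · by_cases h2' : Conn (fun e : {e // ¬ (e ∉ within ends (L ∪ {r, s, d} : Set V))} => ends e.1) τ r d
    · by_cases h3 : Conn (fun e : {e // ¬ (e ∉ within ends (L ∪ {r, s, d} : Set V))} => ends e.1) τ d s
      · -- class `rsd`
        rw [inner_eq_cls_rsd_rsd hL hr hs hd hdr hds hsepN hA h2' h3]
        have hP1 : ¬ ((d ∉ M2 (fun e : {e // ¬ (e ∉ within ends (L ∪ {r, s, d} : Set V))} => ends e.1) r s τ ∧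
          ∀ x ∈ L,
            (Conn (fun e : {e // ¬ (e ∉ within ends (L ∪ {r, s, d} : Set V))} => ends e.1) τ r x ∨ Conn (fun e : {e // ¬ (e ∉ within ends (L ∪ {r, s, d} : Set V))} => ends e.1) τ s x ∨ Conn (fun e : {e // ¬ (e ∉ within ends (L ∪ {r, s, d} : Set V))} => ends e.1) τ d x) →
            x ∉ M2 (fun e : {e // ¬ (e ∉ within ends (L ∪ {r, s, d} : Set V))} => ends e.1) r s τ) ∧ (¬ Conn (fun e : {e // ¬ (e ∉ within ends (L ∪ {r, s, d} : Set V))} => ends e.1) τ r s ∧ ¬ Conn (fun e : {e // ¬ (e ∉ within ends (L ∪ {r, s, d} : Set V))} => ends e.1) τ r d ∧ ¬ Conn (fun e : {e // ¬ (e ∉ within ends (L ∪ {r, s, d} : Set V))} => ends e.1) τ d s)) := by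
          intro h; exact h.2.2.1 h2'
        have hP2 : ¬ ((d ∉ M2 (fun e : {e // ¬ (e ∉ within ends (L ∪ {r, s, d} : Set V))} => ends e.1) r s τ ∧
          ∀ x ∈ L,
            (Conn (fun e : {e // ¬ (e ∉ within ends (L ∪ {r, s, d} : Set V))} => ends e.1) τ r x ∨ Conn (fun e : {e // ¬ (e ∉ within ends (L ∪ {r, s, d} : Set V))} => ends e.1) τ s x ∨ Conn (fun e : {e // ¬ (e ∉ within ends (L ∪ {r, s, d} : Set V))} => ends e.1) τ d x) →
            x ∉ M2 (fun e : {e // ¬ (e ∉ within ends (L ∪ {r, s, d} : Set V))} => ends e.1) r s τ) ∧ (Conn (fun e : {e // ¬ (e ∉ within ends (L ∪ {r, s, d} : Set V))} => ends e.1) τ r s ∧ ¬ Conn (fun e : {e // ¬ (e ∉ within ends (L ∪ {r, s, d} : Set V))} => ends e.1) τ r d ∧ ¬ Conn (fun e : {e // ¬ (e ∉ within ends (L ∪ {r, s, d} : Set V))} => ends e.1) τ d s)) := by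
          intro h; exact h.2.2.1 h2'
        have hP3 : ¬ ((d ∉ M2 (fun e : {e // ¬ (e ∉ within ends (L ∪ {r, s, d} : Set V))} => ends e.1) r s τ ∧
          ∀ x ∈ L,
            (Conn (fun e : {e // ¬ (e ∉ within ends (L ∪ {r, s, d} : Set V))} => ends e.1) τ r x ∨ Conn (fun e : {e // ¬ (e ∉ within ends (L ∪ {r, s, d} : Set V))} => ends e.1) τ s x ∨ Conn (fun e : {e // ¬ (e ∉ within ends (L ∪ {r, s, d} : Set V))} => ends e.1) τ d x) →
            x ∉ M2 (fun e : {e // ¬ (e ∉ within ends (L ∪ {r, s, d} : Set V))} => ends e.1) r s τ) ∧ (Conn (fun e : {e // ¬ (e ∉ within ends (L ∪ {r, s, d} : Set V))} => ends e.1) τ r d ∧ ¬ Conn (fun e : {e // ¬ (e ∉ within ends (L ∪ {r, s, d} : Set V))} => ends e.1) τ d s)) := by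
          intro h; exact h.2.2 h3
        have hP4 : ¬ ((d ∉ M2 (fun e : {e // ¬ (e ∉ within ends (L ∪ {r, s, d} : Set V))} => ends e.1) r s τ ∧
          ∀ x ∈ L,
            (Conn (fun e : {e // ¬ (e ∉ within ends (L ∪ {r, s, d} : Set V))} => ends e.1) τ r x ∨ Conn (fun e : {e // ¬ (e ∉ within ends (L ∪ {r, s, d} : Set V))} => ends e.1) τ s x ∨ Conn (fun e : {e // ¬ (e ∉ within ends (L ∪ {r, s, d} : Set V))} => ends e.1) τ d x) →
            x ∉ M2 (fun e : {e // ¬ (e ∉ within ends (L ∪ {r, s, d} : Set V))} => ends e.1) r s τ) ∧ (¬ Conn (fun e : {e // ¬ (e ∉ within ends (L ∪ {r, s, d} : Set V))} => ends e.1) τ r d ∧ Conn (fun e : {e // ¬ (e ∉ within ends (L ∪ {r, s, d} : Set V))} => ends e.1) τ d s)) := by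
          intro h; exact h.2.1 h2'
        have hP5 : ((d ∉ M2 (fun e : {e // ¬ (e ∉ within ends (L ∪ {r, s, d} : Set V))} => ends e.1) r s τ ∧
          ∀ x ∈ L,
            (Conn (fun e : {e // ¬ (e ∉ within ends (L ∪ {r, s, d} : Set V))} => ends e.1) τ r x ∨ Conn (fun e : {e // ¬ (e ∉ within ends (L ∪ {r, s, d} : Set V))} => ends e.1) τ s x ∨ Conn (fun e : {e // ¬ (e ∉ within ends (L ∪ {r, s, d} : Set V))} => ends e.1) τ d x) →
            x ∉ M2 (fun e : {e // ¬ (e ∉ within ends (L ∪ {r, s, d} : Set V))} => ends e.1) r s τ) ∧ (Conn (fun e : {e // ¬ (e ∉ within ends (L ∪ {r, s, d} : Set V))} => ends e.1) τ r d ∧ Conn (fun e : {e // ¬ (e ∉ within ends (L ∪ {r, s, d} : Set V))} => ends e.1) τ d s)) := ⟨hA, h2', h3⟩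
        rw [if_neg hP1, if_neg hP2, if_neg hP3, if_neg hP4, if_pos hP5]
        ring
      · -- class `rd`
        rw [inner_eq_cls_rd_rsd hL hr hs hd hdr hds hsepN hA h2' h3]
        have hP1 : ¬ ((d ∉ M2 (fun e : {e // ¬ (e ∉ within ends (L ∪ {r, s, d} : Set V))} => ends e.1) r s τ ∧
          ∀ x ∈ L,
            (Conn (fun e : {e // ¬ (e ∉ within ends (L ∪ {r, s, d} : Set V))} => ends e.1) τ r x ∨ Conn (fun e : {e // ¬ (e ∉ within ends (L ∪ {r, s, d} : Set V))} => ends e.1) τ s x ∨ Conn (fun e : {e // ¬ (e ∉ within ends (L ∪ {r, s, d} : Set V))} => ends e.1) τ d x) →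
            x ∉ M2 (fun e : {e // ¬ (e ∉ within ends (L ∪ {r, s, d} : Set V))} => ends e.1) r s τ) ∧ (¬ Conn (fun e : {e // ¬ (e ∉ within ends (L ∪ {r, s, d} : Set V))} => ends e.1) τ r s ∧ ¬ Conn (fun e : {e // ¬ (e ∉ within ends (L ∪ {r, s, d} : Set V))} => ends e.1) τ r d ∧ ¬ Conn (fun e : {e // ¬ (e ∉ within ends (L ∪ {r, s, d} : Set V))} => ends e.1) τ d s)) := by
          intro h; exact h.2.2.1 h2'
        have hP2 : ¬ ((d ∉ M2 (fun e : {e // ¬ (e ∉ within ends (L ∪ {r, s, d} : Set V))} => ends e.1) r s τ ∧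
          ∀ x ∈ L,
            (Conn (fun e : {e // ¬ (e ∉ within ends (L ∪ {r, s, d} : Set V))} => ends e.1) τ r x ∨ Conn (fun e : {e // ¬ (e ∉ within ends (L ∪ {r, s, d} : Set V))} => ends e.1) τ s x ∨ Conn (fun e : {e // ¬ (e ∉ within ends (L ∪ {r, s, d} : Set V))} => ends e.1) τ d x) →
            x ∉ M2 (fun e : {e // ¬ (e ∉ within ends (L ∪ {r, s, d} : Set V))} => ends e.1) r s τ) ∧ (Conn (fun e : {e // ¬ (e ∉ within ends (L ∪ {r, s, d} : Set V))} => ends e.1) τ r s ∧ ¬ Conn (fun e : {e // ¬ (e ∉ within ends (L ∪ {r, s, d} : Set V))} => ends e.1) τ r d ∧ ¬ Conn (fun e : {e // ¬ (e ∉ within ends (L ∪ {r, s, d} : Set V))} => ends e.1) τ d s)) := by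
          intro h; exact h.2.2.1 h2'
        have hP3 : ((d ∉ M2 (fun e : {e // ¬ (e ∉ within ends (L ∪ {r, s, d} : Set V))} => ends e.1) r s τ ∧
          ∀ x ∈ L,
            (Conn (fun e : {e // ¬ (e ∉ within ends (L ∪ {r, s, d} : Set V))} => ends e.1) τ r x ∨ Conn (fun e : {e // ¬ (e ∉ within ends (L ∪ {r, s, d} : Set V))} => ends e.1) τ s x ∨ Conn (fun e : {e // ¬ (e ∉ within ends (L ∪ {r, s, d} : Set V))} => ends e.1) τ d x) →
            x ∉ M2 (fun e : {e // ¬ (e ∉ within ends (L ∪ {r, s, d} : Set V))} => ends e.1) r s τ) ∧ (Conn (fun e : {e // ¬ (e ∉ within ends (L ∪ {r, s, d} : Set V))} => ends e.1) τ r d ∧ ¬ Conn (fun e : {e // ¬ (e ∉ within ends (L ∪ {r, s, d} : Set V))} => ends e.1) τ d s)) := ⟨hA, h2', h3⟩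
        have hP4 : ¬ ((d ∉ M2 (fun e : {e // ¬ (e ∉ within ends (L ∪ {r, s, d} : Set V))} => ends e.1) r s τ ∧
          ∀ x ∈ L,
            (Conn (fun e : {e // ¬ (e ∉ within ends (L ∪ {r, s, d} : Set V))} => ends e.1) τ r x ∨ Conn (fun e : {e // ¬ (e ∉ within ends (L ∪ {r, s, d} : Set V))} => ends e.1) τ s x ∨ Conn (fun e : {e // ¬ (e ∉ within ends (L ∪ {r, s, d} : Set V))} => ends e.1) τ d x) →
            x ∉ M2 (fun e : {e // ¬ (e ∉ within ends (L ∪ {r, s, d} : Set V))} => ends e.1) r s τ) ∧ (¬ Conn (fun e : {e // ¬ (e ∉ within ends (L ∪ {r, s, d} : Set V))} => ends e.1) τ r d ∧ Conn (fun e : {e // ¬ (e ∉ within ends (L ∪ {r, s, d} : Set V))} => ends e.1) τ d s)) := by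
          intro h; exact h.2.1 h2'
        have hP5 : ¬ ((d ∉ M2 (fun e : {e // ¬ (e ∉ within ends (L ∪ {r, s, d} : Set V))} => ends e.1) r s τ ∧
          ∀ x ∈ L,
            (Conn (fun e : {e // ¬ (e ∉ within ends (L ∪ {r, s, d} : Set V))} => ends e.1) τ r x ∨ Conn (fun e : {e // ¬ (e ∉ within ends (L ∪ {r, s, d} : Set V))} => ends e.1) τ s x ∨ Conn (fun e : {e // ¬ (e ∉ within ends (L ∪ {r, s, d} : Set V))} => ends e.1) τ d x) →
            x ∉ M2 (fun e : {e // ¬ (e ∉ within ends (L ∪ {r, s, d} : Set V))} => ends e.1) r s τ) ∧ (Conn (fun e : {e // ¬ (e ∉ within ends (L ∪ {r, s, d} : Set V))} => ends e.1) τ r d ∧ Conn (fun e : {e // ¬ (e ∉ within ends (L ∪ {r, s, d} : Set V))} => ends e.1) τ d s)) := by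
          intro h; exact h3 h.2.2
        rw [if_neg hP1, if_neg hP2, if_pos hP3, if_neg hP4, if_neg hP5]
        ring
    · by_cases h3 : Conn (fun e : {e // ¬ (e ∉ within ends (L ∪ {r, s, d} : Set V))} => ends e.1) τ d s
      · -- class `sd`
        rw [inner_eq_cls_sd_rsd hL hr hs hd hdr hds hsepN hA h2' h3]
        have hP1 : ¬ ((d ∉ M2 (fun e : {e // ¬ (e ∉ within ends (L ∪ {r, s, d} : Set V))} => ends e.1) r s τ ∧
          ∀ x ∈ L,
            (Conn (fun e : {e // ¬ (e ∉ within ends (L ∪ {r, s, d} : Set V))} => ends e.1) τ r x ∨ Conn (fun e : {e // ¬ (e ∉ within ends (L ∪ {r, s, d} : Set V))} => ends e.1) τ s x ∨ Conn (fun e : {e // ¬ (e ∉ within ends (L ∪ {r, s, d} : Set V))} => ends e.1) τ d x) →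
            x ∉ M2 (fun e : {e // ¬ (e ∉ within ends (L ∪ {r, s, d} : Set V))} => ends e.1) r s τ) ∧ (¬ Conn (fun e : {e // ¬ (e ∉ within ends (L ∪ {r, s, d} : Set V))} => ends e.1) τ r s ∧ ¬ Conn (fun e : {e // ¬ (e ∉ within ends (L ∪ {r, s, d} : Set V))} => ends e.1) τ r d ∧ ¬ Conn (fun e : {e // ¬ (e ∉ within ends (L ∪ {r, s, d} : Set V))} => ends e.1) τ d s)) := by
          intro h; exact h.2.2.2 h3
        have hP2 : ¬ ((d ∉ M2 (fun e : {e // ¬ (e ∉ within ends (L ∪ {r, s, d} : Set V))} => ends e.1) r s τ ∧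
          ∀ x ∈ L,
            (Conn (fun e : {e // ¬ (e ∉ within ends (L ∪ {r, s, d} : Set V))} => ends e.1) τ r x ∨ Conn (fun e : {e // ¬ (e ∉ within ends (L ∪ {r, s, d} : Set V))} => ends e.1) τ s x ∨ Conn (fun e : {e // ¬ (e ∉ within ends (L ∪ {r, s, d} : Set V))} => ends e.1) τ d x) →
            x ∉ M2 (fun e : {e // ¬ (e ∉ within ends (L ∪ {r, s, d} : Set V))} => ends e.1) r s τ) ∧ (Conn (fun e : {e // ¬ (e ∉ within ends (L ∪ {r, s, d} : Set V))} => ends e.1) τ r s ∧ ¬ Conn (fun e : {e // ¬ (e ∉ within ends (L ∪ {r, s, d} : Set V))} => ends e.1) τ r d ∧ ¬ Conn (fun e : {e // ¬ (e ∉ within ends (L ∪ {r, s, d} : Set V))} => ends e.1) τ d s)) := by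
          intro h; exact h.2.2.2 h3
        have hP3 : ¬ ((d ∉ M2 (fun e : {e // ¬ (e ∉ within ends (L ∪ {r, s, d} : Set V))} => ends e.1) r s τ ∧
          ∀ x ∈ L,
            (Conn (fun e : {e // ¬ (e ∉ within ends (L ∪ {r, s, d} : Set V))} => ends e.1) τ r x ∨ Conn (fun e : {e // ¬ (e ∉ within ends (L ∪ {r, s, d} : Set V))} => ends e.1) τ s x ∨ Conn (fun e : {e // ¬ (e ∉ within ends (L ∪ {r, s, d} : Set V))} => ends e.1) τ d x) →
            x ∉ M2 (fun e : {e // ¬ (e ∉ within ends (L ∪ {r, s, d} : Set V))} => ends e.1) r s τ) ∧ (Conn (fun e : {e // ¬ (e ∉ within ends (L ∪ {r, s, d} : Set V))} => ends e.1) τ r d ∧ ¬ Conn (fun e : {e // ¬ (e ∉ within ends (L ∪ {r, s, d} : Set V))} => ends e.1) τ d s)) := by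
          intro h; exact h2' h.2.1
        have hP4 : ((d ∉ M2 (fun e : {e // ¬ (e ∉ within ends (L ∪ {r, s, d} : Set V))} => ends e.1) r s τ ∧
          ∀ x ∈ L,
            (Conn (fun e : {e // ¬ (e ∉ within ends (L ∪ {r, s, d} : Set V))} => ends e.1) τ r x ∨ Conn (fun e : {e // ¬ (e ∉ within ends (L ∪ {r, s, d} : Set V))} => ends e.1) τ s x ∨ Conn (fun e : {e // ¬ (e ∉ within ends (L ∪ {r, s, d} : Set V))} => ends e.1) τ d x) →
            x ∉ M2 (fun e : {e // ¬ (e ∉ within ends (L ∪ {r, s, d} : Set V))} => ends e.1) r s τ) ∧ (¬ Conn (fun e : {e // ¬ (e ∉ within ends (L ∪ {r, s, d} : Set V))} => ends e.1) τ r d ∧ Conn (fun e : {e // ¬ (e ∉ within ends (L ∪ {r, s, d} : Set V))} => ends e.1) τ d s)) := ⟨hA, h2', h3⟩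
        have hP5 : ¬ ((d ∉ M2 (fun e : {e // ¬ (e ∉ within ends (L ∪ {r, s, d} : Set V))} => ends e.1) r s τ ∧
          ∀ x ∈ L,
            (Conn (fun e : {e // ¬ (e ∉ within ends (L ∪ {r, s, d} : Set V))} => ends e.1) τ r x ∨ Conn (fun e : {e // ¬ (e ∉ within ends (L ∪ {r, s, d} : Set V))} => ends e.1) τ s x ∨ Conn (fun e : {e // ¬ (e ∉ within ends (L ∪ {r, s, d} : Set V))} => ends e.1) τ d x) →
            x ∉ M2 (fun e : {e // ¬ (e ∉ within ends (L ∪ {r, s, d} : Set V))} => ends e.1) r s τ) ∧ (Conn (fun e : {e // ¬ (e ∉ within ends (L ∪ {r, s, d} : Set V))} => ends e.1) τ r d ∧ Conn (fun e : {e // ¬ (e ∉ within ends (L ∪ {r, s, d} : Set V))} => ends e.1) τ d s)) := by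
          intro h; exact h2' h.2.1
        rw [if_neg hP1, if_neg hP2, if_neg hP3, if_pos hP4, if_neg hP5]
        ring
      · by_cases h1' : Conn (fun e : {e // ¬ (e ∉ within ends (L ∪ {r, s, d} : Set V))} => ends e.1) τ r s
        · -- class `rs`
          rw [inner_eq_cls_rs_rsd hL hr hs hd hdr hds hsepN hA h1' h2' h3]
          have hP1 : ¬ ((d ∉ M2 (fun e : {e // ¬ (e ∉ within ends (L ∪ {r, s, d} : Set V))} => ends e.1) r s τ ∧
          ∀ x ∈ L,
            (Conn (fun e : {e // ¬ (e ∉ within ends (L ∪ {r, s, d} : Set V))} => ends e.1) τ r x ∨ Conn (fun e : {e // ¬ (e ∉ within ends (L ∪ {r, s, d} : Set V))} => ends e.1) τ s x ∨ Conn (fun e : {e // ¬ (e ∉ within ends (L ∪ {r, s, d} : Set V))} => ends e.1) τ d x) →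
            x ∉ M2 (fun e : {e // ¬ (e ∉ within ends (L ∪ {r, s, d} : Set V))} => ends e.1) r s τ) ∧ (¬ Conn (fun e : {e // ¬ (e ∉ within ends (L ∪ {r, s, d} : Set V))} => ends e.1) τ r s ∧ ¬ Conn (fun e : {e // ¬ (e ∉ within ends (L ∪ {r, s, d} : Set V))} => ends e.1) τ r d ∧ ¬ Conn (fun e : {e // ¬ (e ∉ within ends (L ∪ {r, s, d} : Set V))} => ends e.1) τ d s)) := by
            intro h; exact h.2.1 h1'
          have hP2 : ((d ∉ M2 (fun e : {e // ¬ (e ∉ within ends (L ∪ {r, s, d} : Set V))} => ends e.1) r s τ ∧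
          ∀ x ∈ L,
            (Conn (fun e : {e // ¬ (e ∉ within ends (L ∪ {r, s, d} : Set V))} => ends e.1) τ r x ∨ Conn (fun e : {e // ¬ (e ∉ within ends (L ∪ {r, s, d} : Set V))} => ends e.1) τ s x ∨ Conn (fun e : {e // ¬ (e ∉ within ends (L ∪ {r, s, d} : Set V))} => ends e.1) τ d x) →
            x ∉ M2 (fun e : {e // ¬ (e ∉ within ends (L ∪ {r, s, d} : Set V))} => ends e.1) r s τ) ∧ (Conn (fun e : {e // ¬ (e ∉ within ends (L ∪ {r, s, d} : Set V))} => ends e.1) τ r s ∧ ¬ Conn (fun e : {e // ¬ (e ∉ within ends (L ∪ {r, s, d} : Set V))} => ends e.1) τ r d ∧ ¬ Conn (fun e : {e // ¬ (e ∉ within ends (L ∪ {r, s, d} : Set V))} => ends e.1) τ d s)) := ⟨hA, h1', h2', h3⟩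
          have hP3 : ¬ ((d ∉ M2 (fun e : {e // ¬ (e ∉ within ends (L ∪ {r, s, d} : Set V))} => ends e.1) r s τ ∧
          ∀ x ∈ L,
            (Conn (fun e : {e // ¬ (e ∉ within ends (L ∪ {r, s, d} : Set V))} => ends e.1) τ r x ∨ Conn (fun e : {e // ¬ (e ∉ within ends (L ∪ {r, s, d} : Set V))} => ends e.1) τ s x ∨ Conn (fun e : {e // ¬ (e ∉ within ends (L ∪ {r, s, d} : Set V))} => ends e.1) τ d x) →
            x ∉ M2 (fun e : {e // ¬ (e ∉ within ends (L ∪ {r, s, d} : Set V))} => ends e.1) r s τ) ∧ (Conn (fun e : {e // ¬ (e ∉ within ends (L ∪ {r, s, d} : Set V))} => ends e.1) τ r d ∧ ¬ Conn (fun e : {e // ¬ (e ∉ within ends (L ∪ {r, s, d} : Set V))} => ends e.1) τ d s)) := by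
            intro h; exact h2' h.2.1
          have hP4 : ¬ ((d ∉ M2 (fun e : {e // ¬ (e ∉ within ends (L ∪ {r, s, d} : Set V))} => ends e.1) r s τ ∧
          ∀ x ∈ L,
            (Conn (fun e : {e // ¬ (e ∉ within ends (L ∪ {r, s, d} : Set V))} => ends e.1) τ r x ∨ Conn (fun e : {e // ¬ (e ∉ within ends (L ∪ {r, s, d} : Set V))} => ends e.1) τ s x ∨ Conn (fun e : {e // ¬ (e ∉ within ends (L ∪ {r, s, d} : Set V))} => ends e.1) τ d x) →
            x ∉ M2 (fun e : {e // ¬ (e ∉ within ends (L ∪ {r, s, d} : Set V))} => ends e.1) r s τ) ∧ (¬ Conn (fun e : {e // ¬ (e ∉ within ends (L ∪ {r, s, d} : Set V))} => ends e.1) τ r d ∧ Conn (fun e : {e // ¬ (e ∉ within ends (L ∪ {r, s, d} : Set V))} => ends e.1) τ d s)) := by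
            intro h; exact h3 h.2.2
          have hP5 : ¬ ((d ∉ M2 (fun e : {e // ¬ (e ∉ within ends (L ∪ {r, s, d} : Set V))} => ends e.1) r s τ ∧
          ∀ x ∈ L,
            (Conn (fun e : {e // ¬ (e ∉ within ends (L ∪ {r, s, d} : Set V))} => ends e.1) τ r x ∨ Conn (fun e : {e // ¬ (e ∉ within ends (L ∪ {r, s, d} : Set V))} => ends e.1) τ s x ∨ Conn (fun e : {e // ¬ (e ∉ within ends (L ∪ {r, s, d} : Set V))} => ends e.1) τ d x) →
            x ∉ M2 (fun e : {e // ¬ (e ∉ within ends (L ∪ {r, s, d} : Set V))} => ends e.1) r s τ) ∧ (Conn (fun e : {e // ¬ (e ∉ within ends (L ∪ {r, s, d} : Set V))} => ends e.1) τ r d ∧ Conn (fun e : {e // ¬ (e ∉ within ends (L ∪ {r, s, d} : Set V))} => ends e.1) τ d s)) := by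
            intro h; exact h2' h.2.1
          rw [if_neg hP1, if_pos hP2, if_neg hP3, if_neg hP4, if_neg hP5]
          ring
        · -- class `∅`
          rw [inner_eq_cls_empty_rsd hL hr hs hd hdr hds hsepN hA h1' h2' h3]
          have hP1 : ((d ∉ M2 (fun e : {e // ¬ (e ∉ within ends (L ∪ {r, s, d} : Set V))} => ends e.1) r s τ ∧
          ∀ x ∈ L,
            (Conn (fun e : {e // ¬ (e ∉ within ends (L ∪ {r, s, d} : Set V))} => ends e.1) τ r x ∨ Conn (fun e : {e // ¬ (e ∉ within ends (L ∪ {r, s, d} : Set V))} => ends e.1) τ s x ∨ Conn (fun e : {e // ¬ (e ∉ within ends (L ∪ {r, s, d} : Set V))} => ends e.1) τ d x) →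
            x ∉ M2 (fun e : {e // ¬ (e ∉ within ends (L ∪ {r, s, d} : Set V))} => ends e.1) r s τ) ∧ (¬ Conn (fun e : {e // ¬ (e ∉ within ends (L ∪ {r, s, d} : Set V))} => ends e.1) τ r s ∧ ¬ Conn (fun e : {e // ¬ (e ∉ within ends (L ∪ {r, s, d} : Set V))} => ends e.1) τ r d ∧ ¬ Conn (fun e : {e // ¬ (e ∉ within ends (L ∪ {r, s, d} : Set V))} => ends e.1) τ d s)) := ⟨hA, h1', h2', h3⟩
          have hP2 : ¬ ((d ∉ M2 (fun e : {e // ¬ (e ∉ within ends (L ∪ {r, s, d} : Set V))} => ends e.1) r s τ ∧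
          ∀ x ∈ L,
            (Conn (fun e : {e // ¬ (e ∉ within ends (L ∪ {r, s, d} : Set V))} => ends e.1) τ r x ∨ Conn (fun e : {e // ¬ (e ∉ within ends (L ∪ {r, s, d} : Set V))} => ends e.1) τ s x ∨ Conn (fun e : {e // ¬ (e ∉ within ends (L ∪ {r, s, d} : Set V))} => ends e.1) τ d x) →
            x ∉ M2 (fun e : {e // ¬ (e ∉ within ends (L ∪ {r, s, d} : Set V))} => ends e.1) r s τ) ∧ (Conn (fun e : {e // ¬ (e ∉ within ends (L ∪ {r, s, d} : Set V))} => ends e.1) τ r s ∧ ¬ Conn (fun e : {e // ¬ (e ∉ within ends (L ∪ {r, s, d} : Set V))} => ends e.1) τ r d ∧ ¬ Conn (fun e : {e // ¬ (e ∉ within ends (L ∪ {r, s, d} : Set V))} => ends e.1) τ d s)) := by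
            intro h; exact h1' h.2.1
          have hP3 : ¬ ((d ∉ M2 (fun e : {e // ¬ (e ∉ within ends (L ∪ {r, s, d} : Set V))} => ends e.1) r s τ ∧
          ∀ x ∈ L,
            (Conn (fun e : {e // ¬ (e ∉ within ends (L ∪ {r, s, d} : Set V))} => ends e.1) τ r x ∨ Conn (fun e : {e // ¬ (e ∉ within ends (L ∪ {r, s, d} : Set V))} => ends e.1) τ s x ∨ Conn (fun e : {e // ¬ (e ∉ within ends (L ∪ {r, s, d} : Set V))} => ends e.1) τ d x) →
            x ∉ M2 (fun e : {e // ¬ (e ∉ within ends (L ∪ {r, s, d} : Set V))} => ends e.1) r s τ) ∧ (Conn (fun e : {e // ¬ (e ∉ within ends (L ∪ {r, s, d} : Set V))} => ends e.1) τ r d ∧ ¬ Conn (fun e : {e // ¬ (e ∉ within ends (L ∪ {r, s, d} : Set V))} => ends e.1) τ d s)) := by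
            intro h; exact h2' h.2.1
          have hP4 : ¬ ((d ∉ M2 (fun e : {e // ¬ (e ∉ within ends (L ∪ {r, s, d} : Set V))} => ends e.1) r s τ ∧
          ∀ x ∈ L,
            (Conn (fun e : {e // ¬ (e ∉ within ends (L ∪ {r, s, d} : Set V))} => ends e.1) τ r x ∨ Conn (fun e : {e // ¬ (e ∉ within ends (L ∪ {r, s, d} : Set V))} => ends e.1) τ s x ∨ Conn (fun e : {e // ¬ (e ∉ within ends (L ∪ {r, s, d} : Set V))} => ends e.1) τ d x) →
            x ∉ M2 (fun e : {e // ¬ (e ∉ within ends (L ∪ {r, s, d} : Set V))} => ends e.1) r s τ) ∧ (¬ Conn (fun e : {e // ¬ (e ∉ within ends (L ∪ {r, s, d} : Set V))} => ends e.1) τ r d ∧ Conn (fun e : {e // ¬ (e ∉ within ends (L ∪ {r, s, d} : Set V))} => ends e.1) τ d s)) := by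
            intro h; exact h3 h.2.2
          have hP5 : ¬ ((d ∉ M2 (fun e : {e // ¬ (e ∉ within ends (L ∪ {r, s, d} : Set V))} => ends e.1) r s τ ∧
          ∀ x ∈ L,
            (Conn (fun e : {e // ¬ (e ∉ within ends (L ∪ {r, s, d} : Set V))} => ends e.1) τ r x ∨ Conn (fun e : {e // ¬ (e ∉ within ends (L ∪ {r, s, d} : Set V))} => ends e.1) τ s x ∨ Conn (fun e : {e // ¬ (e ∉ within ends (L ∪ {r, s, d} : Set V))} => ends e.1) τ d x) →
            x ∉ M2 (fun e : {e // ¬ (e ∉ within ends (L ∪ {r, s, d} : Set V))} => ends e.1) r s τ) ∧ (Conn (fun e : {e // ¬ (e ∉ within ends (L ∪ {r, s, d} : Set V))} => ends e.1) τ r d ∧ Conn (fun e : {e // ¬ (e ∉ within ends (L ∪ {r, s, d} : Set V))} => ends e.1) τ d s)) := by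
            intro h; exact h2' h.2.1
          rw [if_pos hP1, if_neg hP2, if_neg hP3, if_neg hP4, if_neg hP5]
          ring
  · -- not admissible: every summand of the inner sum vanishes
    have hP1 : ¬ ((d ∉ M2 (fun e : {e // ¬ (e ∉ within ends (L ∪ {r, s, d} : Set V))} => ends e.1) r s τ ∧
          ∀ x ∈ L,
            (Conn (fun e : {e // ¬ (e ∉ within ends (L ∪ {r, s, d} : Set V))} => ends e.1) τ r x ∨ Conn (fun e : {e // ¬ (e ∉ within ends (L ∪ {r, s, d} : Set V))} => ends e.1) τ s x ∨ Conn (fun e : {e // ¬ (e ∉ within ends (L ∪ {r, s, d} : Set V))} => ends e.1) τ d x) →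
            x ∉ M2 (fun e : {e // ¬ (e ∉ within ends (L ∪ {r, s, d} : Set V))} => ends e.1) r s τ) ∧ (¬ Conn (fun e : {e // ¬ (e ∉ within ends (L ∪ {r, s, d} : Set V))} => ends e.1) τ r s ∧ ¬ Conn (fun e : {e // ¬ (e ∉ within ends (L ∪ {r, s, d} : Set V))} => ends e.1) τ r d ∧ ¬ Conn (fun e : {e // ¬ (e ∉ within ends (L ∪ {r, s, d} : Set V))} => ends e.1) τ d s)) := by
      intro h; exact hA h.1
    have hP2 : ¬ ((d ∉ M2 (fun e : {e // ¬ (e ∉ within ends (L ∪ {r, s, d} : Set V))} => ends e.1) r s τ ∧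
          ∀ x ∈ L,
            (Conn (fun e : {e // ¬ (e ∉ within ends (L ∪ {r, s, d} : Set V))} => ends e.1) τ r x ∨ Conn (fun e : {e // ¬ (e ∉ within ends (L ∪ {r, s, d} : Set V))} => ends e.1) τ s x ∨ Conn (fun e : {e // ¬ (e ∉ within ends (L ∪ {r, s, d} : Set V))} => ends e.1) τ d x) →
            x ∉ M2 (fun e : {e // ¬ (e ∉ within ends (L ∪ {r, s, d} : Set V))} => ends e.1) r s τ) ∧ (Conn (fun e : {e // ¬ (e ∉ within ends (L ∪ {r, s, d} : Set V))} => ends e.1) τ r s ∧ ¬ Conn (fun e : {e // ¬ (e ∉ within ends (L ∪ {r, s, d} : Set V))} => ends e.1) τ r d ∧ ¬ Conn (fun e : {e // ¬ (e ∉ within ends (L ∪ {r, s, d} : Set V))} => ends e.1) τ d s)) := by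
      intro h; exact hA h.1
    have hP3 : ¬ ((d ∉ M2 (fun e : {e // ¬ (e ∉ within ends (L ∪ {r, s, d} : Set V))} => ends e.1) r s τ ∧
          ∀ x ∈ L,
            (Conn (fun e : {e // ¬ (e ∉ within ends (L ∪ {r, s, d} : Set V))} => ends e.1) τ r x ∨ Conn (fun e : {e // ¬ (e ∉ within ends (L ∪ {r, s, d} : Set V))} => ends e.1) τ s x ∨ Conn (fun e : {e // ¬ (e ∉ within ends (L ∪ {r, s, d} : Set V))} => ends e.1) τ d x) →
            x ∉ M2 (fun e : {e // ¬ (e ∉ within ends (L ∪ {r, s, d} : Set V))} => ends e.1) r s τ) ∧ (Conn (fun e : {e // ¬ (e ∉ within ends (L ∪ {r, s, d} : Set V))} => ends e.1) τ r d ∧ ¬ Conn (fun e : {e // ¬ (e ∉ within ends (L ∪ {r, s, d} : Set V))} => ends e.1) τ d s)) := by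
      intro h; exact hA h.1
    have hP4 : ¬ ((d ∉ M2 (fun e : {e // ¬ (e ∉ within ends (L ∪ {r, s, d} : Set V))} => ends e.1) r s τ ∧
          ∀ x ∈ L,
            (Conn (fun e : {e // ¬ (e ∉ within ends (L ∪ {r, s, d} : Set V))} => ends e.1) τ r x ∨ Conn (fun e : {e // ¬ (e ∉ within ends (L ∪ {r, s, d} : Set V))} => ends e.1) τ s x ∨ Conn (fun e : {e // ¬ (e ∉ within ends (L ∪ {r, s, d} : Set V))} => ends e.1) τ d x) →
            x ∉ M2 (fun e : {e // ¬ (e ∉ within ends (L ∪ {r, s, d} : Set V))} => ends e.1) r s τ) ∧ (¬ Conn (fun e : {e // ¬ (e ∉ within ends (L ∪ {r, s, d} : Set V))} => ends e.1) τ r d ∧ Conn (fun e : {e // ¬ (e ∉ within ends (L ∪ {r, s, d} : Set V))} => ends e.1) τ d s)) := by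
      intro h; exact hA h.1
    have hP5 : ¬ ((d ∉ M2 (fun e : {e // ¬ (e ∉ within ends (L ∪ {r, s, d} : Set V))} => ends e.1) r s τ ∧
          ∀ x ∈ L,
            (Conn (fun e : {e // ¬ (e ∉ within ends (L ∪ {r, s, d} : Set V))} => ends e.1) τ r x ∨ Conn (fun e : {e // ¬ (e ∉ within ends (L ∪ {r, s, d} : Set V))} => ends e.1) τ s x ∨ Conn (fun e : {e // ¬ (e ∉ within ends (L ∪ {r, s, d} : Set V))} => ends e.1) τ d x) →
            x ∉ M2 (fun e : {e // ¬ (e ∉ within ends (L ∪ {r, s, d} : Set V))} => ends e.1) r s τ) ∧ (Conn (fun e : {e // ¬ (e ∉ within ends (L ∪ {r, s, d} : Set V))} => ends e.1) τ r d ∧ Conn (fun e : {e // ¬ (e ∉ within ends (L ∪ {r, s, d} : Set V))} => ends e.1) τ d s)) := by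
      intro h; exact hA h.1
    rw [if_neg hP1, if_neg hP2, if_neg hP3, if_neg hP4, if_neg hP5]
    refine Finset.sum_eq_zero fun ω' _ => ?_
    rw [if_neg (fun h => hA h.1.2.1)]

/-- **THE SINGLE-`d` STATEMENT for a cluster hanging from `{r, s, d}`** with a non-linking
outside, modulo the F-count inequalities: `dSignSum ≤ 0`. -/
theorem dSignSum_nonpos_of_cluster_rsd
    (hL : ∀ e x y, ends e = s(x, y) → x ∈ L → y ∈ L ∨ y = r ∨ y = s ∨ y = d)
    (hp : p ∉ L) (hq : q ∉ L) (hr : r ∉ L) (hs : s ∉ L) (hd : d ∉ L) (hdr : d ≠ r) (hds : d ≠ s)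
    (hrs : within (fun e : {e // e ∉ within ends (L ∪ {r, s, d} : Set V)} => ends e.1) ({r, s} : Set V) = ∅)
    (hsepN : ¬ Conn (endsD (fun e : {e // e ∉ within ends (L ∪ {r, s, d} : Set V)} => ends e.1) d) (chi (endsD (fun e : {e // e ∉ within ends (L ∪ {r, s, d} : Set V)} => ends e.1) d)
      ({x : V | ∀ e : {e // e ∉ within ends (L ∪ {r, s, d} : Set V)}, (fun e : {e // e ∉ within ends (L ∪ {r, s, d} : Set V)} => ends e.1) e ≠ s(d, x)} ∪ {r, s})) r s)
    (hC1t : (∑ τ : {e // ¬ (e ∉ within ends (L ∪ {r, s, d} : Set V))} → Bool, if (d ∉ M2 (fun e : {e // ¬ (e ∉ within ends (L ∪ {r, s, d} : Set V))} => ends e.1) r s τ ∧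
          ∀ x ∈ L,
            (Conn (fun e : {e // ¬ (e ∉ within ends (L ∪ {r, s, d} : Set V))} => ends e.1) τ r x ∨ Conn (fun e : {e // ¬ (e ∉ within ends (L ∪ {r, s, d} : Set V))} => ends e.1) τ s x ∨ Conn (fun e : {e // ¬ (e ∉ within ends (L ∪ {r, s, d} : Set V))} => ends e.1) τ d x) →
            x ∉ M2 (fun e : {e // ¬ (e ∉ within ends (L ∪ {r, s, d} : Set V))} => ends e.1) r s τ) ∧ (¬ Conn (fun e : {e // ¬ (e ∉ within ends (L ∪ {r, s, d} : Set V))} => ends e.1) τ r s ∧ ¬ Conn (fun e : {e // ¬ (e ∉ within ends (L ∪ {r, s, d} : Set V))} => ends e.1) τ r d ∧ ¬ Conn (fun e : {e // ¬ (e ∉ within ends (L ∪ {r, s, d} : Set V))} => ends e.1) τ d s) ∧ Conn (fun e : {e // ¬ (e ∉ within ends (L ∪ {r, s, d} : Set V))} => ends e.1) (OneColourSwitch.compl τ) r s ∧ (∃ x ∈ L,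
          (Conn (fun e : {e // ¬ (e ∉ within ends (L ∪ {r, s, d} : Set V))} => ends e.1) τ r x ∨ Conn (fun e : {e // ¬ (e ∉ within ends (L ∪ {r, s, d} : Set V))} => ends e.1) τ s x ∨ Conn (fun e : {e // ¬ (e ∉ within ends (L ∪ {r, s, d} : Set V))} => ends e.1) τ d x) ∧
          Conn (fun e : {e // ¬ (e ∉ within ends (L ∪ {r, s, d} : Set V))} => ends e.1) (OneColourSwitch.compl τ) d x) then (1 : ℤ) else 0) ≤ (∑ τ : {e // ¬ (e ∉ within ends (L ∪ {r, s, d} : Set V))} → Bool, if (d ∉ M2 (fun e : {e // ¬ (e ∉ within ends (L ∪ {r, s, d} : Set V))} => ends e.1) r s τ ∧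
          ∀ x ∈ L,
            (Conn (fun e : {e // ¬ (e ∉ within ends (L ∪ {r, s, d} : Set V))} => ends e.1) τ r x ∨ Conn (fun e : {e // ¬ (e ∉ within ends (L ∪ {r, s, d} : Set V))} => ends e.1) τ s x ∨ Conn (fun e : {e // ¬ (e ∉ within ends (L ∪ {r, s, d} : Set V))} => ends e.1) τ d x) →
            x ∉ M2 (fun e : {e // ¬ (e ∉ within ends (L ∪ {r, s, d} : Set V))} => ends e.1) r s τ) ∧ (Conn (fun e : {e // ¬ (e ∉ within ends (L ∪ {r, s, d} : Set V))} => ends e.1) τ r s ∧ ¬ Conn (fun e : {e // ¬ (e ∉ within ends (L ∪ {r, s, d} : Set V))} => ends e.1) τ r d ∧ ¬ Conn (fun e : {e // ¬ (e ∉ within ends (L ∪ {r, s, d} : Set V))} => ends e.1) τ d s) ∧ ¬ Conn (fun e : {e // ¬ (e ∉ within ends (L ∪ {r, s, d} : Set V))} => ends e.1) (OneColourSwitch.compl τ) r s ∧ (∃ x ∈ L,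
          (Conn (fun e : {e // ¬ (e ∉ within ends (L ∪ {r, s, d} : Set V))} => ends e.1) τ r x ∨ Conn (fun e : {e // ¬ (e ∉ within ends (L ∪ {r, s, d} : Set V))} => ends e.1) τ s x ∨ Conn (fun e : {e // ¬ (e ∉ within ends (L ∪ {r, s, d} : Set V))} => ends e.1) τ d x) ∧
          Conn (fun e : {e // ¬ (e ∉ within ends (L ∪ {r, s, d} : Set V))} => ends e.1) (OneColourSwitch.compl τ) d x) then (1 : ℤ) else 0))
    (hC1f : (∑ τ : {e // ¬ (e ∉ within ends (L ∪ {r, s, d} : Set V))} → Bool, if (d ∉ M2 (fun e : {e // ¬ (e ∉ within ends (L ∪ {r, s, d} : Set V))} => ends e.1) r s τ ∧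
          ∀ x ∈ L,
            (Conn (fun e : {e // ¬ (e ∉ within ends (L ∪ {r, s, d} : Set V))} => ends e.1) τ r x ∨ Conn (fun e : {e // ¬ (e ∉ within ends (L ∪ {r, s, d} : Set V))} => ends e.1) τ s x ∨ Conn (fun e : {e // ¬ (e ∉ within ends (L ∪ {r, s, d} : Set V))} => ends e.1) τ d x) →
            x ∉ M2 (fun e : {e // ¬ (e ∉ within ends (L ∪ {r, s, d} : Set V))} => ends e.1) r s τ) ∧ (¬ Conn (fun e : {e // ¬ (e ∉ within ends (L ∪ {r, s, d} : Set V))} => ends e.1) τ r s ∧ ¬ Conn (fun e : {e // ¬ (e ∉ within ends (L ∪ {r, s, d} : Set V))} => ends e.1) τ r d ∧ ¬ Conn (fun e : {e // ¬ (e ∉ within ends (L ∪ {r, s, d} : Set V))} => ends e.1) τ d s) ∧ Conn (fun e : {e // ¬ (e ∉ within ends (L ∪ {r, s, d} : Set V))} => ends e.1) (OneColourSwitch.compl τ) r s ∧ ¬ (∃ x ∈ L,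
          (Conn (fun e : {e // ¬ (e ∉ within ends (L ∪ {r, s, d} : Set V))} => ends e.1) τ r x ∨ Conn (fun e : {e // ¬ (e ∉ within ends (L ∪ {r, s, d} : Set V))} => ends e.1) τ s x ∨ Conn (fun e : {e // ¬ (e ∉ within ends (L ∪ {r, s, d} : Set V))} => ends e.1) τ d x) ∧
          Conn (fun e : {e // ¬ (e ∉ within ends (L ∪ {r, s, d} : Set V))} => ends e.1) (OneColourSwitch.compl τ) d x) then (1 : ℤ) else 0) ≤ (∑ τ : {e // ¬ (e ∉ within ends (L ∪ {r, s, d} : Set V))} → Bool, if (d ∉ M2 (fun e : {e // ¬ (e ∉ within ends (L ∪ {r, s, d} : Set V))} => ends e.1) r s τ ∧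
          ∀ x ∈ L,
            (Conn (fun e : {e // ¬ (e ∉ within ends (L ∪ {r, s, d} : Set V))} => ends e.1) τ r x ∨ Conn (fun e : {e // ¬ (e ∉ within ends (L ∪ {r, s, d} : Set V))} => ends e.1) τ s x ∨ Conn (fun e : {e // ¬ (e ∉ within ends (L ∪ {r, s, d} : Set V))} => ends e.1) τ d x) →
            x ∉ M2 (fun e : {e // ¬ (e ∉ within ends (L ∪ {r, s, d} : Set V))} => ends e.1) r s τ) ∧ (Conn (fun e : {e // ¬ (e ∉ within ends (L ∪ {r, s, d} : Set V))} => ends e.1) τ r s ∧ ¬ Conn (fun e : {e // ¬ (e ∉ within ends (L ∪ {r, s, d} : Set V))} => ends e.1) τ r d ∧ ¬ Conn (fun e : {e // ¬ (e ∉ within ends (L ∪ {r, s, d} : Set V))} => ends e.1) τ d s) ∧ ¬ Conn (fun e : {e // ¬ (e ∉ within ends (L ∪ {r, s, d} : Set V))} => ends e.1) (OneColourSwitch.compl τ) r s ∧ ¬ (∃ x ∈ L,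
          (Conn (fun e : {e // ¬ (e ∉ within ends (L ∪ {r, s, d} : Set V))} => ends e.1) τ r x ∨ Conn (fun e : {e // ¬ (e ∉ within ends (L ∪ {r, s, d} : Set V))} => ends e.1) τ s x ∨ Conn (fun e : {e // ¬ (e ∉ within ends (L ∪ {r, s, d} : Set V))} => ends e.1) τ d x) ∧
          Conn (fun e : {e // ¬ (e ∉ within ends (L ∪ {r, s, d} : Set V))} => ends e.1) (OneColourSwitch.compl τ) d x) then (1 : ℤ) else 0))
    (hC2t : (∑ τ : {e // ¬ (e ∉ within ends (L ∪ {r, s, d} : Set V))} → Bool, if (d ∉ M2 (fun e : {e // ¬ (e ∉ within ends (L ∪ {r, s, d} : Set V))} => ends e.1) r s τ ∧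
          ∀ x ∈ L,
            (Conn (fun e : {e // ¬ (e ∉ within ends (L ∪ {r, s, d} : Set V))} => ends e.1) τ r x ∨ Conn (fun e : {e // ¬ (e ∉ within ends (L ∪ {r, s, d} : Set V))} => ends e.1) τ s x ∨ Conn (fun e : {e // ¬ (e ∉ within ends (L ∪ {r, s, d} : Set V))} => ends e.1) τ d x) →
            x ∉ M2 (fun e : {e // ¬ (e ∉ within ends (L ∪ {r, s, d} : Set V))} => ends e.1) r s τ) ∧ (Conn (fun e : {e // ¬ (e ∉ within ends (L ∪ {r, s, d} : Set V))} => ends e.1) τ r d ∧ ¬ Conn (fun e : {e // ¬ (e ∉ within ends (L ∪ {r, s, d} : Set V))} => ends e.1) τ d s) ∧ Conn (fun e : {e // ¬ (e ∉ within ends (L ∪ {r, s, d} : Set V))} => ends e.1) (OneColourSwitch.compl τ) r s ∧ (∃ x ∈ L,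
          (Conn (fun e : {e // ¬ (e ∉ within ends (L ∪ {r, s, d} : Set V))} => ends e.1) τ r x ∨ Conn (fun e : {e // ¬ (e ∉ within ends (L ∪ {r, s, d} : Set V))} => ends e.1) τ s x ∨ Conn (fun e : {e // ¬ (e ∉ within ends (L ∪ {r, s, d} : Set V))} => ends e.1) τ d x) ∧
          Conn (fun e : {e // ¬ (e ∉ within ends (L ∪ {r, s, d} : Set V))} => ends e.1) (OneColourSwitch.compl τ) d x) then (1 : ℤ) else 0) + (∑ τ : {e // ¬ (e ∉ within ends (L ∪ {r, s, d} : Set V))} → Bool, if (d ∉ M2 (fun e : {e // ¬ (e ∉ within ends (L ∪ {r, s, d} : Set V))} => ends e.1) r s τ ∧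
          ∀ x ∈ L,
            (Conn (fun e : {e // ¬ (e ∉ within ends (L ∪ {r, s, d} : Set V))} => ends e.1) τ r x ∨ Conn (fun e : {e // ¬ (e ∉ within ends (L ∪ {r, s, d} : Set V))} => ends e.1) τ s x ∨ Conn (fun e : {e // ¬ (e ∉ within ends (L ∪ {r, s, d} : Set V))} => ends e.1) τ d x) →
            x ∉ M2 (fun e : {e // ¬ (e ∉ within ends (L ∪ {r, s, d} : Set V))} => ends e.1) r s τ) ∧ (¬ Conn (fun e : {e // ¬ (e ∉ within ends (L ∪ {r, s, d} : Set V))} => ends e.1) τ r d ∧ Conn (fun e : {e // ¬ (e ∉ within ends (L ∪ {r, s, d} : Set V))} => ends e.1) τ d s) ∧ Conn (fun e : {e // ¬ (e ∉ within ends (L ∪ {r, s, d} : Set V))} => ends e.1) (OneColourSwitch.compl τ) r s ∧ (∃ x ∈ L,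
          (Conn (fun e : {e // ¬ (e ∉ within ends (L ∪ {r, s, d} : Set V))} => ends e.1) τ r x ∨ Conn (fun e : {e // ¬ (e ∉ within ends (L ∪ {r, s, d} : Set V))} => ends e.1) τ s x ∨ Conn (fun e : {e // ¬ (e ∉ within ends (L ∪ {r, s, d} : Set V))} => ends e.1) τ d x) ∧
          Conn (fun e : {e // ¬ (e ∉ within ends (L ∪ {r, s, d} : Set V))} => ends e.1) (OneColourSwitch.compl τ) d x) then (1 : ℤ) else 0) ≤ (∑ τ : {e // ¬ (e ∉ within ends (L ∪ {r, s, d} : Set V))} → Bool, if (d ∉ M2 (fun e : {e // ¬ (e ∉ within ends (L ∪ {r, s, d} : Set V))} => ends e.1) r s τ ∧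
          ∀ x ∈ L,
            (Conn (fun e : {e // ¬ (e ∉ within ends (L ∪ {r, s, d} : Set V))} => ends e.1) τ r x ∨ Conn (fun e : {e // ¬ (e ∉ within ends (L ∪ {r, s, d} : Set V))} => ends e.1) τ s x ∨ Conn (fun e : {e // ¬ (e ∉ within ends (L ∪ {r, s, d} : Set V))} => ends e.1) τ d x) →
            x ∉ M2 (fun e : {e // ¬ (e ∉ within ends (L ∪ {r, s, d} : Set V))} => ends e.1) r s τ) ∧ (Conn (fun e : {e // ¬ (e ∉ within ends (L ∪ {r, s, d} : Set V))} => ends e.1) τ r d ∧ Conn (fun e : {e // ¬ (e ∉ within ends (L ∪ {r, s, d} : Set V))} => ends e.1) τ d s) ∧ ¬ Conn (fun e : {e // ¬ (e ∉ within ends (L ∪ {r, s, d} : Set V))} => ends e.1) (OneColourSwitch.compl τ) r s ∧ (∃ x ∈ L,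
          (Conn (fun e : {e // ¬ (e ∉ within ends (L ∪ {r, s, d} : Set V))} => ends e.1) τ r x ∨ Conn (fun e : {e // ¬ (e ∉ within ends (L ∪ {r, s, d} : Set V))} => ends e.1) τ s x ∨ Conn (fun e : {e // ¬ (e ∉ within ends (L ∪ {r, s, d} : Set V))} => ends e.1) τ d x) ∧
          Conn (fun e : {e // ¬ (e ∉ within ends (L ∪ {r, s, d} : Set V))} => ends e.1) (OneColourSwitch.compl τ) d x) then (1 : ℤ) else 0))
    (hC2f : (∑ τ : {e // ¬ (e ∉ within ends (L ∪ {r, s, d} : Set V))} → Bool, if (d ∉ M2 (fun e : {e // ¬ (e ∉ within ends (L ∪ {r, s, d} : Set V))} => ends e.1) r s τ ∧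
          ∀ x ∈ L,
            (Conn (fun e : {e // ¬ (e ∉ within ends (L ∪ {r, s, d} : Set V))} => ends e.1) τ r x ∨ Conn (fun e : {e // ¬ (e ∉ within ends (L ∪ {r, s, d} : Set V))} => ends e.1) τ s x ∨ Conn (fun e : {e // ¬ (e ∉ within ends (L ∪ {r, s, d} : Set V))} => ends e.1) τ d x) →
            x ∉ M2 (fun e : {e // ¬ (e ∉ within ends (L ∪ {r, s, d} : Set V))} => ends e.1) r s τ) ∧ (Conn (fun e : {e // ¬ (e ∉ within ends (L ∪ {r, s, d} : Set V))} => ends e.1) τ r d ∧ ¬ Conn (fun e : {e // ¬ (e ∉ within ends (L ∪ {r, s, d} : Set V))} => ends e.1) τ d s) ∧ Conn (fun e : {e // ¬ (e ∉ within ends (L ∪ {r, s, d} : Set V))} => ends e.1) (OneColourSwitch.compl τ) r s ∧ ¬ (∃ x ∈ L,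
          (Conn (fun e : {e // ¬ (e ∉ within ends (L ∪ {r, s, d} : Set V))} => ends e.1) τ r x ∨ Conn (fun e : {e // ¬ (e ∉ within ends (L ∪ {r, s, d} : Set V))} => ends e.1) τ s x ∨ Conn (fun e : {e // ¬ (e ∉ within ends (L ∪ {r, s, d} : Set V))} => ends e.1) τ d x) ∧
          Conn (fun e : {e // ¬ (e ∉ within ends (L ∪ {r, s, d} : Set V))} => ends e.1) (OneColourSwitch.compl τ) d x) then (1 : ℤ) else 0) + (∑ τ : {e // ¬ (e ∉ within ends (L ∪ {r, s, d} : Set V))} → Bool, if (d ∉ M2 (fun e : {e // ¬ (e ∉ within ends (L ∪ {r, s, d} : Set V))} => ends e.1) r s τ ∧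
          ∀ x ∈ L,
            (Conn (fun e : {e // ¬ (e ∉ within ends (L ∪ {r, s, d} : Set V))} => ends e.1) τ r x ∨ Conn (fun e : {e // ¬ (e ∉ within ends (L ∪ {r, s, d} : Set V))} => ends e.1) τ s x ∨ Conn (fun e : {e // ¬ (e ∉ within ends (L ∪ {r, s, d} : Set V))} => ends e.1) τ d x) →
            x ∉ M2 (fun e : {e // ¬ (e ∉ within ends (L ∪ {r, s, d} : Set V))} => ends e.1) r s τ) ∧ (¬ Conn (fun e : {e // ¬ (e ∉ within ends (L ∪ {r, s, d} : Set V))} => ends e.1) τ r d ∧ Conn (fun e : {e // ¬ (e ∉ within ends (L ∪ {r, s, d} : Set V))} => ends e.1) τ d s) ∧ Conn (fun e : {e // ¬ (e ∉ within ends (L ∪ {r, s, d} : Set V))} => ends e.1) (OneColourSwitch.compl τ) r s ∧ ¬ (∃ x ∈ L,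
          (Conn (fun e : {e // ¬ (e ∉ within ends (L ∪ {r, s, d} : Set V))} => ends e.1) τ r x ∨ Conn (fun e : {e // ¬ (e ∉ within ends (L ∪ {r, s, d} : Set V))} => ends e.1) τ s x ∨ Conn (fun e : {e // ¬ (e ∉ within ends (L ∪ {r, s, d} : Set V))} => ends e.1) τ d x) ∧
          Conn (fun e : {e // ¬ (e ∉ within ends (L ∪ {r, s, d} : Set V))} => ends e.1) (OneColourSwitch.compl τ) d x) then (1 : ℤ) else 0) ≤ (∑ τ : {e // ¬ (e ∉ within ends (L ∪ {r, s, d} : Set V))} → Bool, if (d ∉ M2 (fun e : {e // ¬ (e ∉ within ends (L ∪ {r, s, d} : Set V))} => ends e.1) r s τ ∧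
          ∀ x ∈ L,
            (Conn (fun e : {e // ¬ (e ∉ within ends (L ∪ {r, s, d} : Set V))} => ends e.1) τ r x ∨ Conn (fun e : {e // ¬ (e ∉ within ends (L ∪ {r, s, d} : Set V))} => ends e.1) τ s x ∨ Conn (fun e : {e // ¬ (e ∉ within ends (L ∪ {r, s, d} : Set V))} => ends e.1) τ d x) →
            x ∉ M2 (fun e : {e // ¬ (e ∉ within ends (L ∪ {r, s, d} : Set V))} => ends e.1) r s τ) ∧ (Conn (fun e : {e // ¬ (e ∉ within ends (L ∪ {r, s, d} : Set V))} => ends e.1) τ r d ∧ Conn (fun e : {e // ¬ (e ∉ within ends (L ∪ {r, s, d} : Set V))} => ends e.1) τ d s) ∧ ¬ Conn (fun e : {e // ¬ (e ∉ within ends (L ∪ {r, s, d} : Set V))} => ends e.1) (OneColourSwitch.compl τ) r s ∧ ¬ (∃ x ∈ L,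
          (Conn (fun e : {e // ¬ (e ∉ within ends (L ∪ {r, s, d} : Set V))} => ends e.1) τ r x ∨ Conn (fun e : {e // ¬ (e ∉ within ends (L ∪ {r, s, d} : Set V))} => ends e.1) τ s x ∨ Conn (fun e : {e // ¬ (e ∉ within ends (L ∪ {r, s, d} : Set V))} => ends e.1) τ d x) ∧
          Conn (fun e : {e // ¬ (e ∉ within ends (L ∪ {r, s, d} : Set V))} => ends e.1) (OneColourSwitch.compl τ) d x) then (1 : ℤ) else 0)) :
    dSignSum ends p q r s d ≤ 0 := by
  refine dSignSum_nonpos_of_hdSum_nonpos hdr.symm hds.symm ?_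
  rw [hdSum_eq_two_mul_hdK]
  have := hdK_nonpos_of_cluster_rsd hL hp hq hr hs hd hdr hds hrs hsepN hC1t hC1f hC2t hC2f
  omega

end Theorem

end NoPocket

end Summit.Ventures.PercRepro2
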